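import Summits.Ventures.PercRepro.ProfilePriceSurplus
import Summits.Ventures.PercRepro.Night2ShadowContract
import Summits.Ventures.PercRepro.C025Profile

/-!
# PercRepro — the MIXED-ANTICHAIN profile-Hall form `MAS` and its clean inductive step (p10, gen 0; S5, Proposition 2)

`proofs/SUBCLAIM-S5-p10.md` §2.4, Proposition 2.  For a finite matroid `M` on `E`, a level `u` and a set `B` with
`b = ρ(B)`, `p′ = ρ(E ∖ B)`, the mixed-antichain price is `pi M u B = cpr b p′ u` (`ProfilePriceSurplus.lean`: `1` if
`b = u`, `C(b+p′,u)/C(b+p′,b)` if `b < u ≤ p′`, `0` otherwise), and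

  `MAS M u`:  for every ANTICHAIN `𝒜` of subsets of `E`,  `Σ_{B ∈ 𝒜} pi M u B ≤ #{S : ρ(S) = u, S ⊇ some B ∈ 𝒜}`

(night-2's `Shadow.shadowLevel M u 𝒜`).  Restricted to antichains of rank-`q` sets, `MAS` is night-3's Hall form
`H⁺` (`ProfileHall`); for the free matroid it is the LYM inequality for the upper shadow of an antichain.  THE CLEAN
INDUCTIVE STEP: for a non-loop `e` and an antichain `𝒜` with `e` in NO member (`mas_step_of_notMem`) or in EVERY
member (`mas_step_of_mem`), the inequality for `(M, 𝒜, u)` follows from `MAS (M ＼ {e}) u` and `MAS (M ／ {e}) (u − 1)`: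

* the shadow splits along `e ∈ S` (`card_shadowLevel_split`, `card_shadowLevel_filter_mem`: `S ↦ S ∖ {e}`);
* the price of a member is paid by its prices in the minors: `pi_le_delete_add_contract` (`e ∉ B`, regimes
  `ε = [e ∉ cl(E − e − B)]`, `δ = [e ∈ cl B]`, via `cpr_le_A2` / `cpr_le_A3`) and `pi_le_contract_erase` (`e ∈ B`,
  `η = [e ∉ cl(E ∖ B)]`, via `cpr_le_B1` / `cpr_le_B2`).
The MIXED regime (`e` in some members and not in others, for every `e`) is the open piece (NIGHT-2-shadow.md §8 R2;
S5 §4): there `𝒜₀ ∪ 𝒜₁` need not be an antichain in `M ／ {e}`.  Loops: `ProfileMixedStepLoop.lean`.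
-/

/-! ## The matroid half: the mixed-antichain form MAS and its clean inductive step -/

open scoped Matroid

namespace PercRepro.Skew

open Finset ThmH Shadow Profile

variable {α : Type} [DecidableEq α] {M : Matroid α} [M.Finite]

/-- The natural-number rank of a finset. -/
noncomputable def rk (M : Matroid α) [M.Finite] (X : Finset α) : ℕ := (M.eRk (X : Set α)).toNat

omit [DecidableEq α] in
/-- `↑(rk M X) = M.eRk ↑X` (finsets have finite rank). -/
theorem coe_rk (X : Finset α) : ((rk M X : ℕ) : ℕ∞) = M.eRk (X : Set α) := by
  unfold rk
  apply ENat.coe_toNat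
  apply ne_top_of_le_ne_top _ (M.eRk_le_encard _)
  rw [Set.encard_coe_eq_coe_finsetCard]
  exact ENat.coe_ne_top _

/-- **The mixed-antichain profile price** of `B` in `M` at level `u`: `cpr (ρ B) (ρ (E ∖ B)) u`. -/
noncomputable def pi (M : Matroid α) [M.Finite] (u : ℕ) (B : Finset α) : ℚ :=
  cpr (rk M B) (rk M (gr M \ B)) u

/-- **MAS(M, u)**: for every antichain `𝒜` of subsets of the ground set, the rank-`u` sets above `𝒜` number at
least the total mixed-antichain price of `𝒜`. -/
def MAS (M : Matroid α) [M.Finite] (u : ℕ) : Prop :=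
  ∀ 𝒜 : Finset (Finset α), (∀ B ∈ 𝒜, B ⊆ gr M) → (∀ B ∈ 𝒜, ∀ B' ∈ 𝒜, B ⊆ B' → B = B') →
    ∑ B ∈ 𝒜, pi M u B ≤ ((shadowLevel M u 𝒜).card : ℚ)

/-- Membership in `shadowLevel`. -/
theorem mem_shadowLevel {u : ℕ} {𝒜 : Finset (Finset α)} {S : Finset α} :
    S ∈ shadowLevel M u 𝒜 ↔ (S ⊆ gr M ∧ M.eRk (S : Set α) = (u : ℕ∞)) ∧ ∃ B ∈ 𝒜, B ⊆ S := by
  unfold shadowLevel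
  rw [Finset.mem_filter, mem_levelSet]

/-! ### Ranks in the two single-element minors -/

section Minors

variable {e : α}

/-- Deleting `e` keeps the rank of a finset avoiding `e`. -/
theorem rk_delete {X : Finset α} (hX : X ⊆ (gr M).erase e) : rk (M ＼ ({e} : Set α)) X = rk M X := by
  unfold rk
  congr 1
  apply delete_singleton_eRk_eq
  rw [← coe_gr, ← Finset.coe_erase]; exact_mod_cast hX

/-- Contracting a non-loop `e`: `ρ_{M/e}(X) + 1 = ρ_M(X ∪ e)` for `X` avoiding `e`. -/
theorem rk_contract_add_one (he : M.Indep {e}) {X : Finset α} (hX : X ⊆ (gr M).erase e) :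
    rk (M ／ ({e} : Set α)) X + 1 = rk M (insert e X) := by
  have h := contract_singleton_eRk_add_one he (X := (X : Set α))
    (by rw [← coe_gr, ← Finset.coe_erase]; exact_mod_cast hX)
  rw [← Finset.coe_insert, ← coe_rk, ← coe_rk] at h; exact_mod_cast h

/-- `ρ(X ∪ e) = ρ(X)` if `e ∈ cl X`, `= ρ(X) + 1` otherwise (`e ∈ E`, `X ⊆ E`). -/
theorem rk_insert_eq (he : e ∈ gr M) {X : Finset α} (hX : X ⊆ gr M) :
    rk M (insert e X) = if e ∈ clF M X then rk M X else rk M X + 1 := by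
  have hXE : (X : Set α) ⊆ M.E := by rw [← coe_gr]; exact_mod_cast hX
  have heE : e ∈ M.E := by rw [← coe_gr]; exact_mod_cast he
  split_ifs with h
  · have hcl : e ∈ M.closure (X : Set α) := by rw [← coe_clF]; exact_mod_cast h
    unfold rk
    rw [Finset.coe_insert, eRk_insert_eq_of_mem_closure hXE hcl]
  · have hcl : e ∉ M.closure (X : Set α) := by rw [← coe_clF]; exact_mod_cast h
    have h1 := M.eRk_insert_eq_add_one (X := (X : Set α)) ⟨heE, hcl⟩
    rw [← Finset.coe_insert, ← coe_rk, ← coe_rk] at h1; exact_mod_cast h1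

/-- The ground finset of `M ＼ {e}` (implicit-`e` form of night-2's `gr_delete`). -/
theorem gr_delete' : gr (M ＼ ({e} : Set α)) = (gr M).erase e := gr_delete e
/-- The ground finset of `M ／ {e}` (implicit-`e` form of night-2's `gr_contract`). -/
theorem gr_contract' : gr (M ／ ({e} : Set α)) = (gr M).erase e := gr_contract e

end Minors

/-! ### The shadow split -/

section Split

variable {e : α} {u : ℕ}

/-- The rank-`u` sets above `𝒜` avoiding `e` are the rank-`u` sets of `M ＼ {e}` above `𝒜` (members avoid `e`). -/
theorem shadowLevel_filter_notMem (𝒜 : Finset (Finset α)) :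
    (shadowLevel M u 𝒜).filter (fun S => e ∉ S) = shadowLevel (M ＼ ({e} : Set α)) u 𝒜 := by
  ext S
  rw [Finset.mem_filter, mem_shadowLevel, mem_shadowLevel, gr_delete']
  constructor
  · rintro ⟨⟨⟨hSg, hSu⟩, hB⟩, heS⟩
    have hS' : S ⊆ (gr M).erase e := Finset.subset_erase.2 ⟨hSg, heS⟩
    refine ⟨⟨hS', ?_⟩, hB⟩
    rw [delete_singleton_eRk_eq (by rw [← coe_gr, ← Finset.coe_erase]; exact_mod_cast hS')]
    exact hSu
  · rintro ⟨⟨hS', hSu⟩, hB⟩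
    have heS : e ∉ S := fun h => (Finset.mem_erase.1 (hS' h)).1 rfl
    refine ⟨⟨⟨(Finset.subset_erase.1 hS').1, ?_⟩, hB⟩, heS⟩
    rw [delete_singleton_eRk_eq (by rw [← coe_gr, ← Finset.coe_erase]; exact_mod_cast hS')] at hSu
    exact hSu

/-- The rank-`u` sets above `𝒜` containing the non-loop `e` correspond, by `S ↦ S ∖ {e}`, to the rank-`(u−1)`
sets of `M ／ {e}` above `𝒜.image (·.erase e)` (`u ≥ 1`). -/
theorem card_shadowLevel_filter_mem (he : M.Indep {e}) (hu : 1 ≤ u) (𝒜 : Finset (Finset α)) :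
    ((shadowLevel M u 𝒜).filter (fun S => e ∈ S)).card =
      (shadowLevel (M ／ ({e} : Set α)) (u - 1) (𝒜.image (fun B => B.erase e))).card := by
  have heE : e ∈ gr M := by
    rw [← Finset.mem_coe, coe_gr]; exact he.subset_ground (Set.mem_singleton e)
  apply Finset.card_nbij' (fun S => S.erase e) (fun T => insert e T)
  · intro S hS
    rw [Finset.mem_coe, Finset.mem_filter, mem_shadowLevel] at hS
    obtain ⟨⟨⟨hSg, hSu⟩, B, hB, hBS⟩, heS⟩ := hS
    rw [Finset.mem_coe]
    dsimp only
    rw [mem_shadowLevel, gr_contract']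
    have hS' : S.erase e ⊆ (gr M).erase e := Finset.erase_subset_erase e hSg
    refine ⟨⟨hS', ?_⟩, B.erase e, Finset.mem_image_of_mem _ hB, Finset.erase_subset_erase e hBS⟩
    have h1 := rk_contract_add_one he hS'
    rw [Finset.insert_erase heS] at h1
    have h2 : rk M S = u := by unfold rk; rw [hSu, ENat.toNat_coe]
    rw [← coe_rk]
    congr 1
    omega
  · intro T hT
    rw [Finset.mem_coe, mem_shadowLevel, gr_contract'] at hT
    obtain ⟨⟨hTg, hTu⟩, B', hB', hB'T⟩ := hT
    rw [Finset.mem_image] at hB'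
    obtain ⟨B, hB, rfl⟩ := hB'
    rw [Finset.mem_coe]
    dsimp only
    rw [Finset.mem_filter, mem_shadowLevel]
    have heT : e ∉ T := fun h => (Finset.mem_erase.1 (hTg h)).1 rfl
    refine ⟨⟨⟨Finset.insert_subset heE (Finset.subset_erase.1 hTg).1, ?_⟩, B, hB, ?_⟩,
      Finset.mem_insert_self _ _⟩
    · have h1 := rk_contract_add_one he hTg
      have h2 : rk (M ／ ({e} : Set α)) T = u - 1 := by unfold rk; rw [hTu, ENat.toNat_coe]
      rw [← coe_rk, ← h1, h2]
      congr 1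
      omega
    · intro x hx
      by_cases hxe : x = e
      · subst hxe; exact Finset.mem_insert_self _ _
      · exact Finset.mem_insert_of_mem (hB'T (Finset.mem_erase.2 ⟨hxe, hx⟩))
  · intro S hS
    rw [Finset.mem_coe, Finset.mem_filter] at hS
    dsimp only
    exact Finset.insert_erase hS.2
  · intro T hT
    rw [Finset.mem_coe, mem_shadowLevel, gr_contract'] at hT
    have heT : e ∉ T := fun h => (Finset.mem_erase.1 (hT.1.1 h)).1 rfl
    dsimp only
    exact Finset.erase_insert heT

/-- **The shadow split** for a family whose members avoid the non-loop `e`: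
`#∂_u(𝒜) = #∂^{M＼e}_u(𝒜) + #∂^{M／e}_{u−1}(𝒜)`. -/
theorem card_shadowLevel_split (he : M.Indep {e}) (hu : 1 ≤ u) (𝒜 : Finset (Finset α))
    (hnot : ∀ B ∈ 𝒜, e ∉ B) :
    (shadowLevel M u 𝒜).card =
      (shadowLevel (M ＼ ({e} : Set α)) u 𝒜).card + (shadowLevel (M ／ ({e} : Set α)) (u - 1) 𝒜).card := by
  have himg : 𝒜.image (fun B => B.erase e) = 𝒜 := by
    ext B
    rw [Finset.mem_image]
    constructor
    · rintro ⟨B', hB', rfl⟩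
      rw [Finset.erase_eq_of_notMem (hnot B' hB')]
      exact hB'
    · intro hB
      exact ⟨B, hB, Finset.erase_eq_of_notMem (hnot B hB)⟩
  have h2 := card_shadowLevel_filter_mem he hu 𝒜
  rw [himg] at h2
  rw [← Finset.card_filter_add_card_filter_not (s := shadowLevel M u 𝒜) (fun S => e ∉ S),
    shadowLevel_filter_notMem, ← h2]
  congr 2
  ext S
  simp only [Finset.mem_filter, not_not]

end Split

/-! ### The price of a member in the two minors -/

section Prices

variable {e : α} {u : ℕ}

/-- `(gr M).erase e \ B = (gr M \ B).erase e`. -/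
theorem erase_sdiff (B : Finset α) : (gr M).erase e \ B = (gr M \ B).erase e := by
  ext x
  simp only [Finset.mem_sdiff, Finset.mem_erase]
  tauto

omit [DecidableEq α] in
/-- A non-loop is a ground element. -/
theorem mem_gr_of_indep (he : M.Indep {e}) : e ∈ gr M := by
  rw [← Finset.mem_coe, coe_gr]; exact he.subset_ground (Set.mem_singleton e)

/-- **(A)**: the price of a member avoiding the non-loop `e` is paid by its prices in `M ＼ {e}` (level `u`) and
`M ／ {e}` (level `u − 1`). -/
theorem pi_le_delete_add_contract (he : M.Indep {e}) (hu : 1 ≤ u) {B : Finset α} (hB : B ⊆ gr M)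
    (heB : e ∉ B) :
    pi M u B ≤ pi (M ＼ ({e} : Set α)) u B + pi (M ／ ({e} : Set α)) (u - 1) B := by
  have heE : e ∈ gr M := mem_gr_of_indep he
  have hB' : B ⊆ (gr M).erase e := Finset.subset_erase.2 ⟨hB, heB⟩
  have heC : e ∈ gr M \ B := Finset.mem_sdiff.2 ⟨heE, heB⟩
  have hC' : (gr M \ B).erase e ⊆ (gr M).erase e := Finset.erase_subset_erase e Finset.sdiff_subset
  have hCg : (gr M \ B).erase e ⊆ gr M := hC'.trans (Finset.erase_subset e _)
  -- the ranks in `M`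
  set b := rk M B with hb
  set p' := rk M (gr M \ B) with hp'
  set p₁ := rk M ((gr M \ B).erase e) with hp₁
  have hpp : p' = if e ∈ clF M ((gr M \ B).erase e) then p₁ else p₁ + 1 := by
    rw [hp', ← rk_insert_eq heE hCg, Finset.insert_erase heC]
  -- the ranks in `M ／ {e}`
  have hcB : rk (M ／ ({e} : Set α)) B + 1 = if e ∈ clF M B then b else b + 1 := by
    rw [rk_contract_add_one he hB', rk_insert_eq heE hB]
  have hcC : rk (M ／ ({e} : Set α)) ((gr M \ B).erase e) + 1 = p' := by
    rw [rk_contract_add_one he hC', Finset.insert_erase heC]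
  -- unfold the three prices
  unfold pi
  rw [rk_delete hB', gr_delete', gr_contract', erase_sdiff, rk_delete hC', ← hb, ← hp', ← hp₁]
  by_cases hε : e ∈ clF M ((gr M \ B).erase e)
  · -- ε = 0: the deletion price is the price of `M`
    rw [if_pos hε] at hpp
    rw [← hpp]
    linarith [cpr_nonneg (rk (M ／ ({e} : Set α)) B) (rk (M ／ ({e} : Set α)) ((gr M \ B).erase e)) (u - 1)]
  · rw [if_neg hε] at hpp
    have hp1 : p₁ = p' - 1 := by omega
    have hcC' : rk (M ／ ({e} : Set α)) ((gr M \ B).erase e) = p' - 1 := by omega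
    rw [hp1, hcC']
    by_cases hδ : e ∈ clF M B
    · rw [if_pos hδ] at hcB
      have hb1 : 1 ≤ b := by omega
      have hcB' : rk (M ／ ({e} : Set α)) B = b - 1 := by omega
      rw [hcB']
      rcases lt_trichotomy b u with hlt | heq | hgt
      · rcases le_or_gt u p' with hup | hup
        · exact cpr_le_A3 hb1 hlt.le hup
        · rw [cpr_of_lt_of_gt hlt hup]
          exact add_nonneg (cpr_nonneg _ _ _) (cpr_nonneg _ _ _)
      · subst heq
        rw [cpr_self, cpr_self]
        linarith [cpr_nonneg (b - 1) (p' - 1) (b - 1)]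
      · rw [cpr_of_gt hgt]
        exact add_nonneg (cpr_nonneg _ _ _) (cpr_nonneg _ _ _)
    · rw [if_neg hδ] at hcB
      have hcB' : rk (M ／ ({e} : Set α)) B = b := by omega
      rw [hcB']
      rcases lt_trichotomy b u with hlt | heq | hgt
      · rcases le_or_gt u p' with hup | hup
        · exact cpr_le_A2 hlt.le hup
        · rw [cpr_of_lt_of_gt hlt hup]
          exact add_nonneg (cpr_nonneg _ _ _) (cpr_nonneg _ _ _)
      · subst heq
        rw [cpr_self, cpr_self]
        linarith [cpr_nonneg b (p' - 1) (b - 1)]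
      · rw [cpr_of_gt hgt]
        exact add_nonneg (cpr_nonneg _ _ _) (cpr_nonneg _ _ _)

/-- **(B)**: the price of a member containing the non-loop `e` is paid by the price of `B ∖ {e}` in `M ／ {e}` at
level `u − 1`. -/
theorem pi_le_contract_erase (he : M.Indep {e}) (hu : 1 ≤ u) {B : Finset α} (hB : B ⊆ gr M) (heB : e ∈ B) :
    pi M u B ≤ pi (M ／ ({e} : Set α)) (u - 1) (B.erase e) := by
  have heE : e ∈ gr M := mem_gr_of_indep he
  have hB' : B.erase e ⊆ (gr M).erase e := Finset.erase_subset_erase e hB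
  have heC : e ∉ gr M \ B := fun h => (Finset.mem_sdiff.1 h).2 heB
  have hC' : gr M \ B ⊆ (gr M).erase e := Finset.subset_erase.2 ⟨Finset.sdiff_subset, heC⟩
  set b := rk M B with hb
  set p' := rk M (gr M \ B) with hp'
  have hcB : rk (M ／ ({e} : Set α)) (B.erase e) + 1 = b := by
    rw [rk_contract_add_one he hB', Finset.insert_erase heB]
  have hcC : rk (M ／ ({e} : Set α)) (gr M \ B) + 1 = if e ∈ clF M (gr M \ B) then p' else p' + 1 := by
    rw [rk_contract_add_one he hC', rk_insert_eq heE Finset.sdiff_subset]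
  unfold pi
  rw [gr_contract', Shadow.erase_sdiff_erase, Finset.erase_eq_of_notMem heC, ← hb, ← hp']
  have hb1 : 1 ≤ b := by omega
  have hcB' : rk (M ／ ({e} : Set α)) (B.erase e) = b - 1 := by omega
  rw [hcB']
  by_cases hη : e ∈ clF M (gr M \ B)
  · rw [if_pos hη] at hcC
    have hcC' : rk (M ／ ({e} : Set α)) (gr M \ B) = p' - 1 := by omega
    rw [hcC']
    rcases lt_trichotomy b u with hlt | heq | hgt
    · rcases le_or_gt u p' with hup | hup
      · exact cpr_le_B2 hb1 hlt.le hup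
      · rw [cpr_of_lt_of_gt hlt hup]; exact cpr_nonneg _ _ _
    · subst heq; rw [cpr_self, cpr_self]
    · rw [cpr_of_gt hgt]; exact cpr_nonneg _ _ _
  · rw [if_neg hη] at hcC
    have hcC' : rk (M ／ ({e} : Set α)) (gr M \ B) = p' := by omega
    rw [hcC']
    rcases lt_trichotomy b u with hlt | heq | hgt
    · rcases le_or_gt u p' with hup | hup
      · exact cpr_le_B1 hb1 hlt.le hup
      · rw [cpr_of_lt_of_gt hlt hup]; exact cpr_nonneg _ _ _
    · subst heq; rw [cpr_self, cpr_self]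
    · rw [cpr_of_gt hgt]; exact cpr_nonneg _ _ _

end Prices

/-! ### The clean inductive step (Proposition 2 of S5) -/

section Step

variable {e : α} {u : ℕ}

/-- **Regime «e outside every member»**: the inequality for `(M, 𝒜, u)` follows from `MAS (M ＼ {e}) u` and
`MAS (M ／ {e}) (u − 1)` when the non-loop `e` lies in no member of the antichain `𝒜`. -/
theorem mas_step_of_notMem (he : M.Indep {e}) (hu : 1 ≤ u) (h1 : MAS (M ＼ ({e} : Set α)) u)
    (h2 : MAS (M ／ ({e} : Set α)) (u - 1)) (𝒜 : Finset (Finset α)) (h𝒜 : ∀ B ∈ 𝒜, B ⊆ gr M)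
    (hanti : ∀ B ∈ 𝒜, ∀ B' ∈ 𝒜, B ⊆ B' → B = B') (hnot : ∀ B ∈ 𝒜, e ∉ B) :
    ∑ B ∈ 𝒜, pi M u B ≤ ((shadowLevel M u 𝒜).card : ℚ) := by
  have h𝒜' : ∀ B ∈ 𝒜, B ⊆ (gr M).erase e := fun B hB => Finset.subset_erase.2 ⟨h𝒜 B hB, hnot B hB⟩
  have hd := h1 𝒜 (by rw [gr_delete']; exact h𝒜') hanti
  have hc := h2 𝒜 (by rw [gr_contract']; exact h𝒜') hanti
  rw [card_shadowLevel_split he hu 𝒜 hnot, Nat.cast_add]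
  calc ∑ B ∈ 𝒜, pi M u B
      ≤ ∑ B ∈ 𝒜, (pi (M ＼ ({e} : Set α)) u B + pi (M ／ ({e} : Set α)) (u - 1) B) :=
        Finset.sum_le_sum (fun B hB => pi_le_delete_add_contract he hu (h𝒜 B hB) (hnot B hB))
    _ = ∑ B ∈ 𝒜, pi (M ＼ ({e} : Set α)) u B + ∑ B ∈ 𝒜, pi (M ／ ({e} : Set α)) (u - 1) B :=
        Finset.sum_add_distrib
    _ ≤ ((shadowLevel (M ＼ ({e} : Set α)) u 𝒜).card : ℚ) +
          ((shadowLevel (M ／ ({e} : Set α)) (u - 1) 𝒜).card : ℚ) := add_le_add hd hc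

/-- **Regime «e inside every member»**: the inequality for `(M, 𝒜, u)` follows from `MAS (M ／ {e}) (u − 1)` when
the non-loop `e` lies in every member of the antichain `𝒜`. -/
theorem mas_step_of_mem (he : M.Indep {e}) (hu : 1 ≤ u) (h2 : MAS (M ／ ({e} : Set α)) (u - 1))
    (𝒜 : Finset (Finset α)) (h𝒜 : ∀ B ∈ 𝒜, B ⊆ gr M)
    (hanti : ∀ B ∈ 𝒜, ∀ B' ∈ 𝒜, B ⊆ B' → B = B') (hall : ∀ B ∈ 𝒜, e ∈ B) :
    ∑ B ∈ 𝒜, pi M u B ≤ ((shadowLevel M u 𝒜).card : ℚ) := by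
  -- every rank-`u` set above `𝒜` contains `e`
  have hfilt : (shadowLevel M u 𝒜).filter (fun S => e ∈ S) = shadowLevel M u 𝒜 := by
    ext S
    rw [Finset.mem_filter]
    constructor
    · exact fun h => h.1
    · intro hS
      refine ⟨hS, ?_⟩
      obtain ⟨-, B, hB, hBS⟩ := mem_shadowLevel.1 hS
      exact hBS (hall B hB)
  have hcard := card_shadowLevel_filter_mem (M := M) he hu 𝒜
  rw [hfilt] at hcard
  have hinj : Set.InjOn (fun B => B.erase e) (𝒜 : Set (Finset α)) := by
    intro B hB B' hB' hBB'
    simp only at hBB'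
    rw [← Finset.insert_erase (hall B hB), ← Finset.insert_erase (hall B' hB'), hBB']
  have hc := h2 (𝒜.image (fun B => B.erase e))
    (by
      intro B' hB'
      rw [Finset.mem_image] at hB'
      obtain ⟨B, hB, rfl⟩ := hB'
      rw [gr_contract']
      exact Finset.erase_subset_erase e (h𝒜 B hB))
    (by
      intro B₁ hB₁ B₂ hB₂ hsub
      rw [Finset.mem_image] at hB₁ hB₂
      obtain ⟨B, hB, rfl⟩ := hB₁
      obtain ⟨B', hB', rfl⟩ := hB₂
      have : B ⊆ B' := by
        intro x hx
        by_cases hxe : x = e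
        · subst hxe; exact hall B' hB'
        · exact Finset.mem_of_mem_erase (hsub (Finset.mem_erase.2 ⟨hxe, hx⟩))
      rw [hanti B hB B' hB' this])
  rw [hcard]
  calc ∑ B ∈ 𝒜, pi M u B
      ≤ ∑ B ∈ 𝒜, pi (M ／ ({e} : Set α)) (u - 1) (B.erase e) :=
        Finset.sum_le_sum (fun B hB => pi_le_contract_erase he hu (h𝒜 B hB) (hall B hB))
    _ = ∑ B' ∈ 𝒜.image (fun B => B.erase e), pi (M ／ ({e} : Set α)) (u - 1) B' :=
        (Finset.sum_image hinj).symm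
    _ ≤ _ := hc

end Step

end PercRepro.Skew
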